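import Mathlib
import Summits.KontsevichZagierPeriods.Zeta5Search.KDigitProof
import Summits.KontsevichZagierPeriods.Zeta5Search.KDigitWeightsTwo
import Summits.KontsevichZagierPeriods.Zeta5Search.KDigitSecondFunctional
import Summits.KontsevichZagierPeriods.Zeta5Search.SecondDigitWProof
import Summits.KontsevichZagierPeriods.Zeta5Search.ThirdDigitVTransport
import Summits.KontsevichZagierPeriods.Zeta5Search.FourthOrderReflectD
import Summits.KontsevichZagierPeriods.Zeta5Search.RecordCellADigitsA
import HarnessLib

/-!
# ζ(5) search — the CLASSWISE SECOND `𝒦`-DIGIT, part 1: the terms of `𝒦_x` at a pole to second order (DENOM-LAW D1, prover-d1 gen 19)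

HONEST FRAMING: systematic search; no irrationality claim unless certified.  Cell `pub-zeta5`, track «DENOM-LAW» D1, seat
`denom-prover-d1` gen 19 (`HOME/denom-law/prover-d1/ATTEMPT-19.md` §2).  PART 1 of 2 (this file: norm bookkeeping and the termwise
estimates `kTerm_high/zero/one/two`; part 2 `KSecondDigit.lean`: the point-to-base reduction and the class sum).  The `𝒦`-row analogue of gen-2 g10's (W2)
(`secondDigitW_holds`): for a window prime `p ≥ 5`, `b` in the polytope, and a pole class `x < p` with `E_x ≤ −4`,

  **`‖𝒦_x − (−p)^{E_x+3} ĝ_x (ĉ_x − p φ_x ĉ₂_x)‖_p ≤ p^{−(E_x+5)}`**   (`secondDigitK`),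

`𝒦_x = classK` (the class piece of `kRes`), `ĉ_x = cHat` (first `𝒦`-digit, gen-2 g9), `ĉ₂_x = cHat2` (`KDigitSecondFunctional`),
`ĝ_x = gHat`, `φ_x = phiHat` at the BASE `x` of the class.  gen-2 g10 (`g10/secdigit.py`) recorded the second `𝒦`-digit as «Fermat
quotients enter at this order»; they do enter TERMWISE (weights `g₀ = p²φ_k²`, `g₁ = 2pφ_k(1 − pk^{p−1})`, `g₂ − 1 ≡ −2pk^{p−1}`,
`φ_{k+pℓ} ≡ φ_k − ℓ + pℓk^{p−1} (mod p²)`, `KDigitWeightsTwo`), but in the CLASS SUM the Fermat quotient `F = φ_{x+1}` of the base multiplies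
only `Σρ₁`, `Σ(ρ₂ + ℓρ₁)`, `Σ(ρ₃ + 2ℓρ₂ + ℓ²ρ₁)` — the three residue identities `rhoResidueIdentities_holds`, all `0` when `E_x ≤ −4` —
and `k^{p−1}` multiplies `Σ(ρ₂+ℓρ₁)` and `Σ(ρ₃+2ℓρ₂+ℓ²ρ₁)` likewise (POINTWISE identity `kModel_eq`, checked by `ring`).  At `E_x = −3` the
statement is false (`Σ(ρ₃+2ℓρ₂+ℓ²ρ₁) = 1`).  Exact check (`g19/code/kdig.py`): 1,429 / 1,429 classes with `E ≤ −4` (`p ≤ 7`, multipole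
853, single-pole 576).  Ingredients: Theorem B to second order (`leadingDigit₂`), Theorem A (`clusterBound_holds`), `ĝ`/`φ` along the class
to second order (`padicNorm_gHat_sub_second_le`, `padicNorm_phiHat_sub_le`).  USE: the deep classes of THEOREM A‴ in `𝒦`-form (direction
`τ_K = 2ĉ₂ − Lĉ`).  `p`-adic valuations of rational numbers; nothing about ζ(5), no γ; records in print UNMOVED.
-/

noncomputable section

open Finset

namespace Summit.KontsevichZagierPeriods.Zeta5Search.SecondOrder

open Summit.KontsevichZagierPeriods.Zeta5Search.WedgeDictionary (pfData)
open Summit.KontsevichZagierPeriods.Zeta5Search.CasoratianValuation (InPolytope)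
open Summit.KontsevichZagierPeriods.Zeta5Search.ClusterValuation
open Summit.KontsevichZagierPeriods.Zeta5Search.PadicSeries
open Summit.KontsevichZagierPeriods.Zeta5Search.CellA (padicNorm_classRho_le_one pfData_eq_zero_of_order_le padicNorm_p nI_nat)
open Summit.KontsevichZagierPeriods.Zeta5Search.BigPrime (padicNorm_mul_le_one)

variable {p : ℕ} [hp : Fact p.Prime]

/-! ### Norm bookkeeping -/

/-- Products with two small differences: `‖a‖, ‖c'‖ ≤ 1`, `‖a − a'‖, ‖c − c'‖ ≤ B` ⟹ `‖ac − a'c'‖ ≤ B`. -/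
theorem mul_sub_mul_le {a a' c c' B : ℚ} (ha : padicNorm p a ≤ 1) (hc' : padicNorm p c' ≤ 1)
    (haa : padicNorm p (a - a') ≤ B) (hcc : padicNorm p (c - c') ≤ B) (hB : 0 ≤ B) :
    padicNorm p (a * c - a' * c') ≤ B := by
  have e : a * c - a' * c' = a * (c - c') + (a - a') * c' := by ring
  rw [e]
  refine (padicNorm.nonarchimedean (p := p)).trans (max_le ?_ ?_)
  · rw [padicNorm.mul]
    calc _ ≤ 1 * B := mul_le_mul ha hcc (padicNorm.nonneg _) zero_le_one
      _ = B := one_mul B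
  · rw [padicNorm.mul]
    calc _ ≤ B * 1 := mul_le_mul haa hc' (padicNorm.nonneg _) hB
      _ = B := mul_one B

/-- `‖p·a‖ ≤ p⁻¹·‖a‖`-type bound: `‖a‖ ≤ p^e ⟹ ‖p a‖ ≤ p^{e−1}`. -/
theorem norm_p_mul_le {a : ℚ} {e : ℤ} (ha : padicNorm p a ≤ (p : ℚ) ^ e) : padicNorm p ((p : ℚ) * a) ≤ (p : ℚ) ^ (e - 1) := by
  have h := padicNorm_mul_le (padicNorm_p_le' (p := p)) ha
  rwa [show (-(1 : ℤ)) + e = e - 1 by ring] at h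

/-! ### The terms of `𝒦_x` at a pole, to second order -/

section Terms

variable (b : ℕ → ℤ) (hb : InPolytope b) (hp5 : 5 ≤ p) (hwin : (b 0 + 2 : ℤ) < (p : ℤ) ^ 2)
  {x s : ℕ} (hx : x < p) (hs : s ∈ classSet b p x)
include hb hp5 hwin hs

omit hx in
/-- `o ≥ 3`: `‖c_{o,s}(g_o − [o=2])‖ ≤ p^{−(E+5)}` (Theorem A and `p ∣ g_o`). -/
theorem kTerm_high {o : ℕ} (ho : o < 6) (h3 : 3 ≤ o) :
    padicNorm p (pfData b o s * (((taylorTT p o ((s : ℤ) + 1) : ℤ) : ℚ) - if o = 2 then 1 else 0))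
      ≤ (p : ℚ) ^ (-(classExp b p x + 5)) := by
  have hprime := hp.out
  have hsn : s ≤ (b 0).toNat := le_of_mem_classSet b hs
  by_cases h0 : pfData b o s = 0
  · rw [h0, zero_mul, padicNorm.zero]; exact zpow_p_nonneg _
  have hA := clusterBound_holds b p s o hb hprime (by omega) hwin hsn ho h0
  rw [classExp_eq_of_mem hs] at hA
  have hc : padicNorm p (pfData b o s) ≤ (p : ℚ) ^ (-((o : ℤ) + 1 + classExp b p x)) :=
    padicNorm_le_of_val fun _ => hA
  exact (padicNorm_mul_le hc (padicNorm_taylorTT_sub_le hp5 ho _)).trans (zpow_le_zpow_right₀ one_le_p (by omega))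

include hx

/-- Common data at a pole `s` of the class of `x`: the norms of the class quantities are `≤ 1`. -/
theorem kTerm_norms :
    padicNorm p (gHat b p s) ≤ 1 ∧ padicNorm p (gHat b p x) ≤ 1 ∧ padicNorm p (phiHat b p s) ≤ 1 ∧
      padicNorm p (phiHat b p x) ≤ 1 ∧ (∀ σ, padicNorm p (classRho b p s σ) ≤ 1) ∧
      padicNorm p (((s / p : ℕ) : ℚ)) ≤ 1 ∧ padicNorm p ((fq p ((s : ℤ) + 1) : ℚ)) ≤ 1 ∧
      padicNorm p ((fq p ((x : ℤ) + 1) : ℚ)) ≤ 1 := by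
  obtain ⟨hbox, -, -, hn⟩ := thmA_data b hb hwin
  have h0 : 0 ≤ b 0 := hbox.1
  have hp2 : p ≠ 2 := by omega
  have hsn : s ≤ (b 0).toNat := le_of_mem_classSet b hs
  have hxmem : x ∈ classSet b p x := by
    refine mem_filter.2 ⟨mem_range.2 ?_, rfl⟩
    have := mem_range.1 (mem_filter.1 hs).1
    have hsx : s % p = x % p := (mem_filter.1 hs).2
    rw [Nat.mod_eq_of_lt hx] at hsx
    have : x ≤ s := hsx ▸ Nat.mod_le s p
    omega
  exact ⟨(padicNorm_gHat_class b hb hp5 hx hs hxmem).1, (padicNorm_gHat_class b hb hp5 hx hxmem hxmem).1,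
    padicNorm_phiHat_le_one b hp2 s, padicNorm_phiHat_le_one b hp2 x, fun σ => padicNorm_classRho_le_one b h0 hsn hn hp2 σ,
    nI_nat _, padicNorm_fq_le_one _, padicNorm_fq_le_one _⟩

/-- `o = 0`: `‖c_{0,s}·g₀ − (−p)^{E+3} ĝ_s (ρ₁ − pφ_sρ₂) φ_{s+1}²‖ ≤ p^{−(E+5)}` at a pole `s`. -/
theorem kTerm_zero (hspole : netExp b s < 0) :
    padicNorm p (pfData b 0 s * (((taylorTT p 0 ((s : ℤ) + 1) : ℤ) : ℚ) - if 0 = 2 then 1 else 0)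
      - (-(p : ℚ)) ^ (classExp b p x + 3) * (gHat b p s *
        ((classRho b p s 1 - (p : ℚ) * phiHat b p s * (if netExp b s ≤ -2 then classRho b p s 2 else 0))
          * ((fq p ((s : ℤ) + 1) : ℚ)) ^ 2)))
      ≤ (p : ℚ) ^ (-(classExp b p x + 5)) := by
  have hprime := hp.out
  have hp2 : p ≠ 2 := by omega
  have hp0 : (p : ℚ) ≠ 0 := Nat.cast_ne_zero.2 hprime.ne_zero
  have hp' : (-(p : ℚ)) ≠ 0 := neg_ne_zero.2 hp0
  have hsn : s ≤ (b 0).toNat := le_of_mem_classSet b hs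
  have hEs : classExp b p s = classExp b p x := classExp_eq_of_mem hs
  obtain ⟨hgs, -, hφs, -, hρ, -, hf, -⟩ := kTerm_norms b hb hp5 hwin hx hs
  set E := classExp b p x with hE
  set ρ2 : ℚ := if netExp b s ≤ -2 then classRho b p s 2 else 0 with hρ2
  set f : ℚ := (fq p ((s : ℤ) + 1) : ℚ) with hfdef
  -- Theorem B to second order at `σ = 1`
  have hB : padicNorm p (pfData b 0 s - (-(p : ℚ)) ^ (E + 1) * gHat b p s *
      (classRho b p s 1 - (p : ℚ) * phiHat b p s * ρ2)) ≤ (p : ℚ) ^ (-(E + 3)) := by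
    have h := leadingDigit₂ b hb hp5 hwin hsn (σ := 1) le_rfl (by push_cast; omega)
    have e2 : (if ((1 : ℕ) : ℤ) + 1 ≤ -netExp b s then classRho b p s (1 + 1) else 0) = ρ2 := by
      rw [hρ2]
      by_cases h2 : netExp b s ≤ -2
      · rw [if_pos (by push_cast; omega), if_pos h2]
      · rw [if_neg (by push_cast; omega), if_neg h2]
    rw [e2, hEs, show (1 : ℕ) - 1 = 0 from rfl, show ((1 : ℕ) : ℤ) + E = E + 1 by ring] at h
    rw [show -(E + 3) = -(E + 1 + 2) by ring]
    exact h
  rw [if_neg (by decide), sub_zero, taylorTT_zero_cast hp2]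
  have hpow3 : (-(p : ℚ)) ^ (E + 3) = (-(p : ℚ)) ^ (E + 1) * (p : ℚ) ^ 2 := by
    rw [show E + 3 = E + 1 + 2 by ring, zpow_add₀ hp', show ((-(p : ℚ)) ^ (2 : ℤ)) = (p : ℚ) ^ 2 by
      rw [zpow_two]; ring]
  have e : pfData b 0 s * ((p : ℚ) ^ 2 * f ^ 2)
      - (-(p : ℚ)) ^ (E + 3) * (gHat b p s * ((classRho b p s 1 - (p : ℚ) * phiHat b p s * ρ2) * f ^ 2))
      = (pfData b 0 s - (-(p : ℚ)) ^ (E + 1) * gHat b p s * (classRho b p s 1 - (p : ℚ) * phiHat b p s * ρ2))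
        * ((p : ℚ) ^ 2 * f ^ 2) := by
    rw [hpow3]; ring
  rw [e]
  have hf2 : padicNorm p ((p : ℚ) ^ 2 * f ^ 2) ≤ (p : ℚ) ^ (-(2 : ℤ)) := by
    have : padicNorm p (f ^ 2) ≤ (p : ℚ) ^ (0 : ℤ) := by
      rw [zpow_zero, pow_two]; exact padicNorm_mul_le_one hf hf
    have h := padicNorm_mul_le (padicNorm_p_sq_le (p := p)) this
    rwa [show (-(2 : ℤ)) + 0 = -2 by ring] at h
  have h := padicNorm_mul_le hB hf2
  rwa [show -(E + 3) + -(2 : ℤ) = -(E + 5) by ring] at h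

/-- `o = 1`: `‖c_{1,s}·g₁ − (−p)^{E+3} ĝ_s·(−2φ_{s+1}(1 − p(s+1)^{p−1})(ρ₂ − pφ_sρ₃))‖ ≤ p^{−(E+5)}` at a pole `s`
(`ρ₂ := 0` for a simple pole, `ρ₃ := 0` unless the pole order is `≥ 3`). -/
theorem kTerm_one (hspole : netExp b s < 0) :
    padicNorm p (pfData b 1 s * (((taylorTT p 1 ((s : ℤ) + 1) : ℤ) : ℚ) - if 1 = 2 then 1 else 0)
      - (-(p : ℚ)) ^ (classExp b p x + 3) * (gHat b p s *
        (-2 * (fq p ((s : ℤ) + 1) : ℚ) * (1 - (p : ℚ) * ((((s : ℤ) + 1 : ℤ)) : ℚ) ^ (p - 1)) *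
          ((if netExp b s ≤ -2 then classRho b p s 2 else 0)
            - (p : ℚ) * phiHat b p s * (if netExp b s ≤ -3 then classRho b p s 3 else 0)))))
      ≤ (p : ℚ) ^ (-(classExp b p x + 5)) := by
  have hprime := hp.out
  have hp2 : p ≠ 2 := by omega
  have hp0 : (p : ℚ) ≠ 0 := Nat.cast_ne_zero.2 hprime.ne_zero
  have hp' : (-(p : ℚ)) ≠ 0 := neg_ne_zero.2 hp0
  have hsn : s ≤ (b 0).toNat := le_of_mem_classSet b hs
  have hEs : classExp b p s = classExp b p x := classExp_eq_of_mem hs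
  obtain ⟨hgs, -, hφs, -, hρ, -, hf, -⟩ := kTerm_norms b hb hp5 hwin hx hs
  set E := classExp b p x with hE
  set ρ2 : ℚ := if netExp b s ≤ -2 then classRho b p s 2 else 0 with hρ2
  set ρ3 : ℚ := if netExp b s ≤ -3 then classRho b p s 3 else 0 with hρ3
  set f : ℚ := (fq p ((s : ℤ) + 1) : ℚ) with hfdef
  set kp : ℚ := ((((s : ℤ) + 1 : ℤ)) : ℚ) ^ (p - 1) with hkp
  rw [if_neg (by decide), sub_zero, taylorTT_one_cast hp2]
  by_cases h2 : netExp b s ≤ -2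
  · rw [hρ2, if_pos h2]
    -- Theorem B to second order at `σ = 2`
    have hB : padicNorm p (pfData b 1 s - (-(p : ℚ)) ^ (E + 2) * gHat b p s *
        (classRho b p s 2 - (p : ℚ) * phiHat b p s * ρ3)) ≤ (p : ℚ) ^ (-(E + 4)) := by
      have h := leadingDigit₂ b hb hp5 hwin hsn (σ := 2) (by norm_num) (by push_cast; omega)
      have e3 : (if ((2 : ℕ) : ℤ) + 1 ≤ -netExp b s then classRho b p s (2 + 1) else 0) = ρ3 := by
        rw [hρ3]
        by_cases h3 : netExp b s ≤ -3
        · rw [if_pos (by push_cast; omega), if_pos h3]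
        · rw [if_neg (by push_cast; omega), if_neg h3]
      rw [e3, hEs, show (2 : ℕ) - 1 = 1 from rfl, show ((2 : ℕ) : ℤ) + E = E + 2 by ring] at h
      rw [show -(E + 4) = -(E + 2 + 2) by ring]
      exact h
    have hpow3 : (-(p : ℚ)) ^ (E + 3) = (-(p : ℚ)) ^ (E + 2) * (-(p : ℚ)) := by
      rw [show E + 3 = E + 2 + 1 by ring, zpow_add_one₀ hp']
    have e : pfData b 1 s * (2 * (p : ℚ) * f * (1 - (p : ℚ) * kp))
        - (-(p : ℚ)) ^ (E + 3) * (gHat b p s * (-2 * f * (1 - (p : ℚ) * kp) * (classRho b p s 2 - (p : ℚ) * phiHat b p s * ρ3)))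
        = (pfData b 1 s - (-(p : ℚ)) ^ (E + 2) * gHat b p s * (classRho b p s 2 - (p : ℚ) * phiHat b p s * ρ3))
          * (2 * (p : ℚ) * f * (1 - (p : ℚ) * kp)) := by
      rw [hpow3]; ring
    rw [e]
    have hg1 : padicNorm p (2 * (p : ℚ) * f * (1 - (p : ℚ) * kp)) ≤ (p : ℚ) ^ (-(1 : ℤ)) := by
      have h2n : padicNorm p (2 : ℚ) ≤ 1 := by simpa using nI_nat (p := p) 2
      have hkp1 : padicNorm p kp ≤ 1 := by rw [hkp]; exact padicNorm_int_pow_le_one _ _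
      have hu : padicNorm p (1 - (p : ℚ) * kp) ≤ 1 :=
        fo_sub (by simp) (padicNorm_mul_le_one (by simpa using nI_nat (p := p) p) hkp1)
      have e2 : 2 * (p : ℚ) * f * (1 - (p : ℚ) * kp) = (p : ℚ) * (2 * f * (1 - (p : ℚ) * kp)) := by ring
      rw [e2]
      have := norm_p_mul_le (p := p) (e := 0) (by rw [zpow_zero]; exact padicNorm_mul_le_one (padicNorm_mul_le_one h2n hf) hu)
      simpa using this
    have h := padicNorm_mul_le hB hg1
    rwa [show -(E + 4) + -(1 : ℤ) = -(E + 5) by ring] at h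
  · -- simple pole: `c_{1,s} = 0`, `ρ₂ = ρ₃ = 0`
    rw [hρ2, if_neg h2, hρ3, if_neg (show ¬ netExp b s ≤ -3 by omega),
      pfData_eq_zero_of_order_le b hb hsn (by norm_num) (by push_cast; omega)]
    simp only [zero_mul, mul_zero, sub_zero, padicNorm.zero]
    exact zpow_p_nonneg _

/-- `o = 2`: `‖c_{2,s}·(g₂ − 1) − (−p)^{E+3} ĝ_s·(−2p(x+1)^{p−1} ρ₃)‖ ≤ p^{−(E+5)}` at a pole `s` (`ρ₃ := 0` unless order `≥ 3`). -/
theorem kTerm_two (hspole : netExp b s < 0) :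
    padicNorm p (pfData b 2 s * (((taylorTT p 2 ((s : ℤ) + 1) : ℤ) : ℚ) - if 2 = 2 then 1 else 0)
      - (-(p : ℚ)) ^ (classExp b p x + 3) * (gHat b p s *
        (-2 * (p : ℚ) * ((((x : ℤ) + 1) ^ (p - 1) : ℤ) : ℚ) * (if netExp b s ≤ -3 then classRho b p s 3 else 0))))
      ≤ (p : ℚ) ^ (-(classExp b p x + 5)) := by
  have hprime := hp.out
  have hp2 : p ≠ 2 := by omega
  have hp0 : (p : ℚ) ≠ 0 := Nat.cast_ne_zero.2 hprime.ne_zero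
  have hp' : (-(p : ℚ)) ≠ 0 := neg_ne_zero.2 hp0
  have hsn : s ≤ (b 0).toNat := le_of_mem_classSet b hs
  have hEs : classExp b p s = classExp b p x := classExp_eq_of_mem hs
  obtain ⟨hgs, -, -, -, hρ, -, -, -⟩ := kTerm_norms b hb hp5 hwin hx hs
  set E := classExp b p x with hE
  rw [if_pos rfl]
  by_cases h3 : netExp b s ≤ -3
  · rw [if_pos h3]
    -- Theorem B (first order) at `σ = 3`
    have hB : padicNorm p (pfData b 2 s - (-(p : ℚ)) ^ (E + 3) * gHat b p s * classRho b p s 3) ≤ (p : ℚ) ^ (-(E + 4)) := by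
      refine padicNorm_le_of_val fun hne => ?_
      have h := leadingDigit_holds b p s 3 hb hprime hp5 hwin hsn (by norm_num) (by push_cast; omega)
        (by rw [hEs, show ((3 : ℕ) : ℤ) + E = E + 3 by ring]; exact hne)
      rw [hEs, show ((3 : ℕ) : ℤ) + E = E + 3 by ring] at h
      push_cast at h ⊢
      linarith
    -- `g₂(s+1) − 1 ≡ −2p(x+1)^{p−1}`
    have hlvl : ((s : ℤ) + 1) = ((x : ℤ) + 1) + (p : ℤ) * (((s / p : ℕ) : ℤ)) := succ_eq_succ_add_mul_lvl hx hs
    have hg2 : padicNorm p ((((taylorTT p 2 ((s : ℤ) + 1) : ℤ)) : ℚ) - 1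
        + 2 * (p : ℚ) * ((((x : ℤ) + 1 : ℤ)) : ℚ) ^ (p - 1)) ≤ (p : ℚ) ^ (-(2 : ℤ)) := by
      rw [hlvl]; exact padicNorm_taylorTT_two_shift_le hp2 _ _
    have hg2' : padicNorm p ((((taylorTT p 2 ((s : ℤ) + 1) : ℤ)) : ℚ) - 1) ≤ (p : ℚ) ^ (-(1 : ℤ)) := by
      have := padicNorm_taylorTT_sub_le (p := p) hp5 (o := 2) (by norm_num) ((s : ℤ) + 1)
      rwa [if_pos rfl] at this
    have e : pfData b 2 s * ((((taylorTT p 2 ((s : ℤ) + 1) : ℤ)) : ℚ) - 1)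
        - (-(p : ℚ)) ^ (E + 3) * (gHat b p s * (-2 * (p : ℚ) * ((((x : ℤ) + 1) ^ (p - 1) : ℤ) : ℚ) * classRho b p s 3))
        = (pfData b 2 s - (-(p : ℚ)) ^ (E + 3) * gHat b p s * classRho b p s 3) * ((((taylorTT p 2 ((s : ℤ) + 1) : ℤ)) : ℚ) - 1)
          + (-(p : ℚ)) ^ (E + 3) * (gHat b p s * classRho b p s 3) *
            (((((taylorTT p 2 ((s : ℤ) + 1) : ℤ)) : ℚ) - 1) + 2 * (p : ℚ) * ((((x : ℤ) + 1 : ℤ)) : ℚ) ^ (p - 1)) := by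
      push_cast; ring
    rw [e]
    refine fo_add ?_ ?_
    · have h := padicNorm_mul_le hB hg2'
      rwa [show -(E + 4) + -(1 : ℤ) = -(E + 5) by ring] at h
    · have h1 : padicNorm p ((-(p : ℚ)) ^ (E + 3) * (gHat b p s * classRho b p s 3)) ≤ (p : ℚ) ^ (-(E + 3)) := by
        have h := padicNorm_mul_le (padicNorm_neg_p_zpow (p := p) (E + 3))
          (show padicNorm p (gHat b p s * classRho b p s 3) ≤ (p : ℚ) ^ (0 : ℤ) by
            rw [zpow_zero]; exact padicNorm_mul_le_one hgs (hρ 3))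
        rwa [add_zero] at h
      have h := padicNorm_mul_le h1 hg2
      rwa [show -(E + 3) + -(2 : ℤ) = -(E + 5) by ring] at h
  · -- pole order ≤ 2: `c_{2,s} = 0`, `ρ₃ := 0`
    rw [if_neg h3, pfData_eq_zero_of_order_le b hb hsn (by norm_num) (by push_cast; omega)]
    simp only [zero_mul, mul_zero, sub_zero, padicNorm.zero]
    exact zpow_p_nonneg _


end Terms

end Summit.KontsevichZagierPeriods.Zeta5Search.SecondOrder

end
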